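import Literature.AnabelianGeometry.AbsoluteAnabelian.MonoidKummerModelProofs

/-!
# Kummer-faithfulness of the model `TM`-pair for COMPACT `Π_k` (PROOF-ONLY companion)

Companion of `MonoidKummerModel.lean` (S. Mochizuki, *Topics in absolute anabelian geometry III*, §3,
Def. 3.1 (i) p. 66, Prop. 3.2 (ii) p. 71; bib key `MochizukiAbsTopIII2015`, lit key
`paper:url-5493eb38cbb7`).  Def. 3.1 (i) only asks that `ε_k : Π_k ↠ G_k` be a continuous surjection of
topological groups, and `ModelMLFGaloisData` types exactly that; the Kummer-injectivity theorems of
`MonoidKummerModel.lean` (`kummer_injective_of_isOpen`, `kummer_injective`) need the image of an open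
subgroup of `Π_k` to be open in `G_k`, i.e. `ε_k` OPEN.  In the situation of the text — `Π_k` an étale
fundamental group, hence PROFINITE, in particular compact — this is automatic: a continuous surjective
homomorphism from a compact group onto the Hausdorff group `G_k` (Krull topology) is a closed, hence
quotient, hence open map.  This file records that and the resulting unconditional Kummer-faithfulness:

* `ModelMLFGaloisData.isQuotientMap_aug_of_compactSpace`, `isOpenMap_aug_of_compactSpace`;
* `ModelMLFGaloisData.kummer_injective_of_compactSpace` — for compact `Π_k` the Kummer map
  `(𝒪_k̄^⊳)^H → H¹(H, Λ(k̄ˣ))` of the model is injective at EVERY open subgroup `H ⊆ Π_k`;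
* `ModelMLFGaloisData.kummerLim_injective_of_compactSpace` — and so is the Kummer map into the direct
  limit `𝒪_k̄^⊳ → lim→_J H¹(J, Λ(k̄ˣ))` (`MonoidKummerModelProofs.kummerLim_injective`).

HONEST FRAMING: OUR kernel check of classical facts; nothing here bears on [IUTchIII] Cor. 3.12.
-/

noncomputable section

namespace Literature.AnabelianGeometry.AbsoluteAnabelian

universe u

namespace ModelMLFGaloisData

section General

variable {k : Type u} [Field k] {K : Type u} [Field K] [Algebra k K] [Algebra.IsIntegral k K]
  (D : ModelMLFGaloisData k K)

/-- For compact `Π_k`, the augmentation `ε_k : Π_k ↠ G_k` is a quotient map (continuous surjection from a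
compact space onto the Hausdorff Krull-topologised Galois group ⇒ closed map ⇒ quotient map).
[cite: MochizukiAbsTopIII2015, Definition 3.1 (i) p.66] -/
theorem isQuotientMap_aug_of_compactSpace [CompactSpace D.Pi] : Topology.IsQuotientMap D.aug :=
  IsClosedMap.isQuotientMap D.continuous_aug.isClosedMap D.continuous_aug D.aug_surjective

/-- For compact `Π_k`, the augmentation `ε_k : Π_k ↠ G_k` is an OPEN map (a quotient homomorphism of
topological groups is open). [cite: MochizukiAbsTopIII2015, Definition 3.1 (i) p.66] -/
theorem isOpenMap_aug_of_compactSpace [CompactSpace D.Pi] : IsOpenMap D.aug :=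
  (MonoidHom.isOpenQuotientMap_of_isQuotientMap (φ := D.aug)
    D.isQuotientMap_aug_of_compactSpace).isOpenMap

end General

section Kummer

variable (C : MLFClosure.{0}) (D : ModelMLFGaloisData C.k C.K)

/-- **Kummer-faithfulness of the model for compact `Π_k`**: if `Π_k` is compact (e.g. profinite — the
étale fundamental groups of the text), the Kummer map `(𝒪_k̄^⊳)^H → H¹(H, Λ(k̄ˣ))` of the model `TM`-pair
is injective at every open subgroup `H ⊆ Π_k`.
[cite: MochizukiAbsTopIII2015, Proposition 3.2 (ii) p.71] -/
theorem kummer_injective_of_compactSpace [CompactSpace D.Pi] (H : OpenSubgroup D.tmPair.Pi) :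
    Function.Injective ((D.kummerTheory C).kummer H) :=
  D.kummer_injective C D.isOpenMap_aug_of_compactSpace H

/-- **Kummer-faithfulness into the direct limit, compact case**: for compact `Π_k` the Kummer map
`𝒪_k̄^⊳ → lim→_J H¹(J, Λ(k̄ˣ))` of Prop. 3.2 (ii) is injective.
[cite: MochizukiAbsTopIII2015, Proposition 3.2 (ii) p.71] -/
theorem kummerLim_injective_of_compactSpace [CompactSpace D.Pi] :
    Function.Injective (D.kummerTheory C).kummerLim :=
  D.kummerLim_injective C D.isOpenMap_aug_of_compactSpace

end Kummer

end ModelMLFGaloisData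

end Literature.AnabelianGeometry.AbsoluteAnabelian

end
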